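import Mathlib
import Literature.AlgebraicGeometry.Resolution.CobordantGame
import Literature.AlgebraicGeometry.Resolution.CobordantChartCoefficients
import Literature.AlgebraicGeometry.Resolution.CobordantChartPlaneSlice
import Literature.AlgebraicGeometry.Resolution.CobordantTupleGame
import Literature.AlgebraicGeometry.Resolution.FormalCoordinateChange
import Summits.ResolutionOfSingularities.ResolutionOfSingularities.Theorems.WeightedInvariantLocalWeightedDropMonicLinearBlowup
import Summits.ResolutionOfSingularities.ResolutionOfSingularities.Theorems.WeightedInvariantLocalWeightedDropTerminalDoublePointsDimAux
import Summits.ResolutionOfSingularities.ResolutionOfSingularities.Theorems.WeightedInvariantLocalWeightedDropWildTerminalCalculus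

/-!
# `WeightedInvariant.LocalWeightedDrop`: the TERMINAL double points in EVERY dimension — the two LINE STEPS (hyperbolic bottom, three odd slots)

Crux item stmt-ResolutionOfSingularities-8899 `LocalWeightedDrop` (route `ResolutionOfSingularities/WeightedInvariant`), skeleton v29,
residual stubs W4|₄ `stub_wildWideApexFourStartsWon` / W4|₅₊ `stub_wildWideApexFiveUpStartsWon`.  [OURS · L1 W4.3, chain w43, stub
worker 4 (gen 4): the END-GAME of the `d = 2` wild residual in every dimension — the dimension-generic twin of stub worker 3's
S2iT `stub_charTwoInseparableTerminalWon` (`m = 2` old variables only, p479529); replaces the role of the «monomial case / small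
residual case» of a resolution algorithm for double points; NOT a statement of any manuscript.]

This file: the two moves of the END-GAME (all exponents `≤ 1`, `K = {i : μ_i = 1}`) of the monomial case `y² + x^μ · U`
(`μ ∉ 2ℕ^{m+1}`), both blow-ups of a LINE `V(x_a, x_b, y)` through two slots of `K` (weights `𝟙_{a,b}` on the old variables, `1`
at `y`; every exceptional point tame):
* `won_dp_X_mul_X_mul` — THE HYPERBOLIC BOTTOM `#K = 2`, `y² + x_a x_b · U`: won in ONE move with NO singular successor at all
  (`c_a ≠ 0` leaves the linear term `c_a U(0) · x_b'`, `c_b ≠ 0` the term `c_b U(0) · x_a'`, `c_a = c_b = 0` forces `γ ≠ 0` and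
  the constant term `γ²`); every field, NO hypothesis on other germs;
* `won_dp_of_lineStep` — `#K ≥ 3` (NEW IN DIMENSION `≥ 3`, e.g. `y² + x₀x₁x₂`): a third slot `e ∈ K` makes the line permissible
  for the brick `won_monic_of_linearBlowup` (`B(0) = 0`), and the slice at a live slot `i₀ ∈ {a, b}` is `x^{μ'} · unit` with
  `μ' = μ` off `{a, b}`, `μ'_{i₀} = 0`, `μ'_{other} = [c_{other} = 0]`, transported along `Fin.cycleRange i₀` — so `Σ μ` drops and
  `μ'_e = 1` stays odd; stated as a step lemma against an induction hypothesis on `Σ μ`.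
The point blow-up would NOT do at `#K ≥ 3` (it reproduces `y² + x₀x₁x₂` at the exceptional point `(c₀, 0, 0)`), and no
coordinate hyperplane `V(x_i, y)` is permissible there (`x_i² ∤ A₀`).
Tools: the chart transform of a unit monomial (`subst_chart_prod_X_pow_mul`), slices of products of linear factors
(`slice_prod_linFactors_mul`; `WildTerminal.constantCoeff_slice` reused), linear coefficients (`coeff_single_linFactors_mul`, `coeff_single_succ_subst_chart`).
-/

set_option linter.dupNamespace false -- mandated namespace of this single-conjunct summit

namespace Summit.ResolutionOfSingularities.ResolutionOfSingularities.Theorems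

open Literature.AlgebraicGeometry.Resolution
open Literature.AlgebraicGeometry.Resolution.CobordantGame

namespace TerminalDoublePointDim

open MvPowerSeries

variable {k : Type} [Field k] {m : ℕ}

/-! ### The hyperbolic bottom `y² + x_a x_b · U`: one move, no singular successor -/

/-- The linear coefficient of `x_l · G` at `x_l` is `G(0)` (any variable set). -/
theorem coeff_single_X_mul' {σ : Type} (l : σ) (G : MvPowerSeries σ k) :
    coeff (Finsupp.single l 1) (X l * G) = constantCoeff G := by
  classical
  rw [X_def, coeff_monomial_mul, if_pos le_rfl, tsub_self, one_mul, coeff_zero_eq_constantCoeff_apply]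

/-- The linear coefficient of `x_a · G` at another variable `x_b` vanishes. -/
theorem coeff_single_X_mul_of_ne {σ : Type} {a b : σ} (hab : a ≠ b) (G : MvPowerSeries σ k) :
    coeff (Finsupp.single b 1) (X a * G) = 0 := by
  classical
  rw [X_def, coeff_monomial_mul, if_neg]
  rw [Finsupp.single_le_iff, Finsupp.single_apply, if_neg (fun h => hab h.symm)]
  exact Nat.not_succ_le_zero 0

/-- The linear coefficient at `x_b'` of `(c_a + x_a')(c_b + x_b') · G` is `c_a · G(0)` when `G` has no `x_b'`-term. -/
theorem coeff_single_linFactors_mul {σ : Type} {a b : σ} (hab : a ≠ b) (ca cb : k) (G : MvPowerSeries σ k)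
    (hG : coeff (Finsupp.single b 1) G = 0) :
    coeff (Finsupp.single b 1) ((C ca + X a) * (C cb + X b) * G) = ca * constantCoeff G := by
  have hexp : (C ca + X a) * (C cb + X b) * G =
      C (ca * cb) * G + C ca * (X b * G) + C cb * (X a * G) + X a * (X b * G) := by
    rw [map_mul]; ring
  rw [hexp, map_add, map_add, map_add, coeff_C_mul, hG, mul_zero, zero_add, coeff_C_mul, coeff_single_X_mul', coeff_C_mul,
    coeff_single_X_mul_of_ne hab, mul_zero, add_zero, coeff_single_X_mul_of_ne hab, add_zero]

/-- Under a chart with `w_b > 0` the transform of any series has no `x_b'`-linear term (every `x_b'` comes with an `s`). -/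
theorem coeff_single_succ_subst_chart {n : ℕ} (w : Fin n → ℕ) (c : Fin n → k) (hc : ∀ i, w i = 0 → c i = 0)
    (U : MvPowerSeries (Fin n) k) (b : Fin n) (hwb : w b ≠ 0) :
    coeff (Finsupp.single b.succ 1) (subst (CobordantChart.chart w c) U) = 0 := by
  classical
  rw [← Finsupp.cons_zero_single_eq_single_succ, CobordantChart.coeff_cons_single_subst_chart w c hc U 0 b,
    CobordantChart.initEvalD]
  apply finsum_eq_zero_of_forall_eq_zero
  intro d
  split_ifs with hd
  · have hdb : d b = 0 := by have := Finsupp.le_weight w hwb d; omega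
    rw [hdb, Nat.cast_zero, zero_mul, zero_mul, mul_zero]
  · rfl

/-- The linear coefficient of `(γ + Y)²` at a variable other than `Y` vanishes. -/
theorem coeff_single_C_add_X_sq_of_ne {N : ℕ} (γ : k) (v : Fin (N + 1)) (hv : v ≠ Fin.last N) :
    coeff (Finsupp.single v 1) ((C γ + X (Fin.last N)) ^ 2 : MvPowerSeries (Fin (N + 1)) k) = 0 := by
  have h : ((C γ + X (Fin.last N)) ^ 2 : MvPowerSeries (Fin (N + 1)) k) =
      C (γ ^ 2) + C (2 * γ) * X (Fin.last N) + X (Fin.last N) ^ 2 := by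
    rw [map_pow, map_mul, map_ofNat]; ring
  rw [h, map_add, map_add, coeff_C, if_neg (Finsupp.single_ne_zero.mpr one_ne_zero), coeff_C_mul, coeff_X,
    if_neg (fun h' => hv ((Finsupp.single_left_inj one_ne_zero).mp h')), mul_zero, coeff_X_pow, if_neg, add_zero, add_zero]
  rw [Finsupp.single_eq_single_iff]
  rintro (⟨-, h12⟩ | ⟨h10, -⟩)
  · exact absurd h12 (by norm_num)
  · exact absurd h10 one_ne_zero

/-- The constant coefficient of `(γ + Y)²` is `γ²`. -/
theorem constantCoeff_C_add_X_sq {N : ℕ} (γ : k) :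
    constantCoeff ((C γ + X (Fin.last N)) ^ 2 : MvPowerSeries (Fin (N + 1)) k) = γ ^ 2 := by
  rw [map_pow, map_add, constantCoeff_C, constantCoeff_X, add_zero]

/-- THE HYPERBOLIC BOTTOM `y² + x_a x_b · U` (`a ≠ b`, `U(0) ≠ 0`; every characteristic, every field, every dimension, NO hypothesis
on other germs): won in ONE move, the blow-up of the line `V(x_a, x_b, y)` — Refuter has no singular exceptional point at all
(`c_a ≠ 0` leaves the linear term `c_a U(0) · x_b'`, `c_b ≠ 0` the term `c_b U(0) · x_a'`, `c_a = c_b = 0` forces `γ ≠ 0` and the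
constant term `γ²`). -/
theorem won_dp_X_mul_X_mul (k : Type) [Field k] {m : ℕ} (a b : Fin (m + 1)) (hab : a ≠ b)
    {U : MvPowerSeries (Fin (m + 1)) k} (hU : constantCoeff U ≠ 0) :
    CobordantGame.Won k (m + 1 + 1) (X (Fin.last (m + 1)) ^ 2 + rename (Fin.succAboveEmb (Fin.last (m + 1))) (X a * X b * U)) := by
  classical
  set w : Fin (m + 1) → ℕ := fun l => if l = a ∨ l = b then 1 else 0 with hw
  set Wt : Fin (m + 1 + 1) → ℕ := Fin.insertNth (α := fun _ => ℕ) (Fin.last (m + 1)) 1 w with hWtdef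
  set P : MvPowerSeries (Fin (m + 1 + 1)) k := X (Fin.last (m + 1)) ^ 2 +
    rename (Fin.succAboveEmb (Fin.last (m + 1))) (X a * X b * U) with hP
  have hWtlast : Wt (Fin.last (m + 1)) = 1 := by rw [hWtdef, Fin.insertNth_apply_same]
  have hWtcast : ∀ l, Wt (Fin.castSucc l) = w l := fun l => by rw [hWtdef, MonicLinearBlowup.insertNth_castSucc]
  have hwa : w a = 1 := by rw [hw]; dsimp only; rw [if_pos (Or.inl rfl)]
  have hwb : w b = 1 := by rw [hw]; dsimp only; rw [if_pos (Or.inr rfl)]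
  -- the move: identity coordinates, weights `Wt = (𝟙_{a,b}, 1)`
  have hmove : IsMove k (X : Fin (m + 1 + 1) → MvPowerSeries (Fin (m + 1 + 1)) k) Wt := by
    refine ⟨fun l => constantCoeff_X l, ?_, ⟨Fin.last (m + 1), by rw [hWtlast]; exact one_pos⟩⟩
    rw [← FormalCoordChange.linSubst_one, ConeDichotomy.linMat_linSubst, Matrix.det_one]
    exact isUnit_one
  refine Won.move X Wt hmove fun g hg => ?_
  obtain ⟨pt, e, ⟨l, hWl, hptl⟩, hfac, hndvd, hsing⟩ := hg
  exfalso
  have hself : subst (X : Fin (m + 1 + 1) → MvPowerSeries (Fin (m + 1 + 1)) k) P = P := by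
    rw [subst_self]; rfl
  rw [hself] at hfac
  -- the exceptional point of the old slots and the factorisation data
  set c : Fin (m + 1) → k := fun l => if 0 < w l then pt (Fin.castSucc l) else 0 with hc
  have hc0 : ∀ l, w l = 0 → c l = 0 := fun l hl => by
    rw [hc]; dsimp only; rw [hl, if_neg (lt_irrefl 0)]
  have hca : c a = pt (Fin.castSucc a) := by rw [hc]; dsimp only; rw [hwa, if_pos one_pos]
  have hcb : c b = pt (Fin.castSucc b) := by rw [hc]; dsimp only; rw [hwb, if_pos one_pos]
  have hch := CobordantChart.hasSubst_chart w c hc0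
  set Uc : MvPowerSeries (Fin (m + 1 + 1)) k := subst (CobordantChart.chart w c) U with hUc
  have hUc0 : constantCoeff Uc = constantCoeff U := by
    rw [hUc]
    exact constantCoeff_subst_of_constantCoeff_zero _ (fun l => by
      rw [CobordantChart.chart_apply, map_mul, map_add, constantCoeff_C, constantCoeff_X, add_zero, map_pow, constantCoeff_X]
      by_cases hl : w l = 0
      · rw [hc0 l hl, mul_zero]
      · rw [zero_pow hl, zero_mul]) U
  set F : MvPowerSeries (Fin (m + 1 + 1)) k := (C (c a) + X a.succ) * (C (c b) + X b.succ) * Uc with hF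
  set B : Fin 2 → MvPowerSeries (Fin (m + 1 + 1)) k := ![F, 0] with hB
  have hBfac : ∀ j : Fin 2, subst (CobordantChart.chart w c) ((![X a * X b * U, 0] : Fin 2 → MvPowerSeries (Fin (m + 1)) k) j) =
      X 0 ^ (2 - (j : ℕ)) * B j := by
    intro j
    fin_cases j
    · simp only [hB, hF, Fin.zero_eta, Matrix.cons_val_zero, Nat.sub_zero]
      rw [subst_mul hch, subst_mul hch, subst_X hch, subst_X hch, CobordantChart.chart_apply, CobordantChart.chart_apply, hwa, hwb]
      ring
    · simp only [hB, Fin.mk_one, Matrix.cons_val_one, Matrix.cons_val_zero]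
      rw [← coe_substAlgHom hch, map_zero, mul_zero]
  set γ : k := pt (Fin.last (m + 1)) with hγ
  set g₀ : MvPowerSeries (Fin (m + 1 + 1 + 1)) k := (C γ + X (Fin.last (m + 1 + 1))) ^ 2 +
    ∑ j : Fin 2, rename (Fin.succAboveEmb (Fin.last (m + 1 + 1))) (B j) * (C γ + X (Fin.last (m + 1 + 1))) ^ (j : ℕ) with hg₀
  have hT : subst (cruxChart k Wt pt) P = X 0 ^ 2 * g₀ := by
    rw [hP, dp_eq_sum, hWtdef, MonicLinearBlowup.transform_linear w _ pt B hBfac]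
  have hndvd₀ : ¬ X 0 ∣ g₀ := MonicLinearBlowup.not_X_dvd_g₀ γ B
  rw [hT] at hfac
  obtain ⟨-, hgg⟩ := X_pow_mul_eq_X_pow_mul 0 hfac hndvd₀ hndvd
  subst hgg
  have hg₀' : g₀ = (C γ + X (Fin.last (m + 1 + 1))) ^ 2 + rename (Fin.succAboveEmb (Fin.last (m + 1 + 1))) F := by
    rw [hg₀, Fin.sum_univ_two]
    simp [hB]
  -- case analysis on the exceptional point
  by_cases ha : pt (Fin.castSucc a) = 0
  · by_cases hb : pt (Fin.castSucc b) = 0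
    · -- `c_a = c_b = 0`: the live slot is `y`, `γ ≠ 0`, and `g₀(0) = γ² ≠ 0`
      have hl : l = Fin.last (m + 1) := by
        rcases Fin.eq_castSucc_or_eq_last l with ⟨i, rfl⟩ | h
        · exfalso
          have hwi : 0 < w i := by rwa [hWtcast] at hWl
          rw [hw] at hwi
          dsimp only at hwi
          by_cases hi : i = a ∨ i = b
          · rcases hi with rfl | rfl
            · exact hptl ha
            · exact hptl hb
          · rw [if_neg hi] at hwi
            exact lt_irrefl 0 hwi
        · exact h
      have hγ0 : γ ≠ 0 := by rw [hγ, ← hl]; exact hptl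
      have h00 := hsing.1
      rw [hg₀', map_add, constantCoeff_C_add_X_sq, constantCoeff_rename, hF, map_mul, map_mul, map_add, map_add,
        constantCoeff_C, constantCoeff_C, constantCoeff_X, constantCoeff_X, add_zero, add_zero, hca, ha, zero_mul, zero_mul,
        add_zero] at h00
      exact hγ0 (pow_eq_zero_iff two_ne_zero |>.mp h00)
    · -- `c_b ≠ 0`: the linear term `c_b U(0) · x_a'` survives
      have h1 := hsing.2 (Fin.castSucc a.succ)
      rw [hg₀', map_add, coeff_single_C_add_X_sq_of_ne γ _ (Fin.castSucc_lt_last _).ne, zero_add,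
        ← embDomain_single (m := m + 1), coeff_embDomain_rename, hF,
        mul_comm (C (c a) + X a.succ) (C (c b) + X b.succ),
        coeff_single_linFactors_mul (fun h => hab (Fin.succ_injective _ h).symm) (c b) (c a) Uc
          (coeff_single_succ_subst_chart w c hc0 U a (by rw [hwa]; exact one_ne_zero)), hUc0, hcb] at h1
      exact mul_ne_zero hb hU h1
  · -- `c_a ≠ 0`: the linear term `c_a U(0) · x_b'` survives
    have h1 := hsing.2 (Fin.castSucc b.succ)
    rw [hg₀', map_add, coeff_single_C_add_X_sq_of_ne γ _ (Fin.castSucc_lt_last _).ne, zero_add,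
      ← embDomain_single (m := m + 1), coeff_embDomain_rename, hF,
      coeff_single_linFactors_mul (fun h => hab (Fin.succ_injective _ h)) (c a) (c b) Uc
        (coeff_single_succ_subst_chart w c hc0 U b (by rw [hwb]; exact one_ne_zero)), hUc0, hca] at h1
    exact mul_ne_zero ha hU h1


/-! ### The line step at three odd slots -/

/-- THE CHART TRANSFORM OF A UNIT MONOMIAL: `(x^μ · U) ∘ chart_w(c) = s^{w·μ} · (∏_l (c_l + x_l')^{μ_l} · U ∘ chart_w(c))`. -/
theorem subst_chart_prod_X_pow_mul {n : ℕ} (w : Fin n → ℕ) (c : Fin n → k) (hc : ∀ i, w i = 0 → c i = 0)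
    (μ : Fin n → ℕ) (U : MvPowerSeries (Fin n) k) :
    subst (CobordantChart.chart w c) ((∏ l, X l ^ μ l) * U) =
      X 0 ^ (∑ l, w l * μ l) * ((∏ l, (C (c l) + X l.succ) ^ μ l) * subst (CobordantChart.chart w c) U) := by
  have hch := CobordantChart.hasSubst_chart w c hc
  rw [← coe_substAlgHom hch, map_mul, map_prod]
  simp only [map_pow, coe_substAlgHom, subst_X hch, CobordantChart.chart_apply, mul_pow, ← pow_mul]
  rw [Finset.prod_mul_distrib, Finset.prod_pow_eq_pow_sum]
  ring

/-- The transform under `chart_w(c)` does not change constant terms. -/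
theorem constantCoeff_subst_chart {n : ℕ} (w : Fin n → ℕ) (c : Fin n → k) (hc : ∀ i, w i = 0 → c i = 0)
    (U : MvPowerSeries (Fin n) k) : constantCoeff (subst (CobordantChart.chart w c) U) = constantCoeff U :=
  constantCoeff_subst_of_constantCoeff_zero _ (fun l => by
    rw [CobordantChart.chart_apply, map_mul, map_add, constantCoeff_C, constantCoeff_X, add_zero, map_pow, constantCoeff_X]
    by_cases hl : w l = 0
    · rw [hc l hl, mul_zero]
    · rw [zero_pow hl, zero_mul]) U

/-- The weight-`𝟙_{a,b}` degree of `x^μ` is `μ_a + μ_b`. -/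
theorem sum_indicator_pair_mul {n : ℕ} {a b : Fin n} (hab : a ≠ b) (μ : Fin n → ℕ) :
    ∑ l, (if l = a ∨ l = b then 1 else 0) * μ l = μ a + μ b := by
  rw [Finset.sum_eq_add a b hab]
  · rw [if_pos (Or.inl rfl), if_pos (Or.inr rfl), one_mul, one_mul]
  · rintro l - ⟨hla, hlb⟩
    rw [if_neg (not_or.mpr ⟨hla, hlb⟩), zero_mul]
  · exact fun h => absurd (Finset.mem_univ a) h
  · exact fun h => absurd (Finset.mem_univ b) h

/-- THE SLICE OF A PRODUCT OF LINEAR FACTORS: `(∏_l (c_l + x_l')^{μ_l} · G)|_{x'_{i₀} = 0} =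
∏_l (c_l + [l ≠ i₀] x_{π l})^{μ_l} · G|_{x'_{i₀} = 0}`. -/
theorem slice_prod_linFactors_mul (i₀ : Fin (m + 1)) (c : Fin (m + 1) → k) (μ : Fin (m + 1) → ℕ)
    (G : MvPowerSeries (Fin (m + 1 + 1)) k) :
    TupleGame.slice i₀ ((∏ l, (C (c l) + X l.succ) ^ μ l) * G) =
      (∏ l, (C (c l) + if l = i₀ then (0 : MvPowerSeries (Fin (m + 1)) k) else X (Fin.predAbove i₀ l.succ)) ^ μ l) *
        TupleGame.slice i₀ G := by
  have hsl := CobordantChartPlaneSlice.hasSubst_slice (R := k) (n := m + 1) i₀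
  unfold TupleGame.slice
  rw [← coe_substAlgHom hsl, map_mul, map_prod]
  simp only [map_pow, map_add, coe_substAlgHom, subst_C, subst_X hsl, Fin.succ_inj]

/-- THE LINE STEP AT THREE ODD SLOTS (`#K ≥ 3`).  Let `A₀ = x^μ · U` with all `μ_l ≤ 1`, `U(0) ≠ 0`, and three distinct slots
`a, b, e` with `μ = 1`.  Blow up the line `V(x_a, x_b, y)` (`won_monic_of_linearBlowup` with `w = 𝟙_{a,b}`; permissible because
`x_e` survives in `B`, so `B(0) = 0`).  At a singular exceptional point the live slot `i₀` is `a` or `b`, and the slice is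
`x^{μ'} · U'` with `U'(0) ≠ 0`, `μ'_{π e} = 1` odd and `Σ μ' < Σ μ` (`π = Fin.cycleRange i₀`) — won by the induction hypothesis
`IH` on `Σ μ`. -/
theorem won_dp_of_lineStep (p : ℕ) (hp : p.Prime) (k : Type) [Field k] [CharP k p] {m : ℕ} (μ : Fin (m + 1) → ℕ)
    (hμ : ∀ l, μ l ≤ 1) (a b e : Fin (m + 1)) (hab : a ≠ b) (hea : e ≠ a) (heb : e ≠ b)
    (ha : μ a = 1) (hb : μ b = 1) (he : μ e = 1) (U : MvPowerSeries (Fin (m + 1)) k) (hU : constantCoeff U ≠ 0)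
    (IH : ∀ (μ' : Fin (m + 1) → ℕ) (U' : MvPowerSeries (Fin (m + 1)) k), constantCoeff U' ≠ 0 → (∃ l, Odd (μ' l)) →
      ∑ l, μ' l < ∑ l, μ l →
      CobordantGame.Won k (m + 1 + 1) (X (Fin.last (m + 1)) ^ 2 +
        rename (Fin.succAboveEmb (Fin.last (m + 1))) ((∏ l, X l ^ μ' l) * U'))) :
    CobordantGame.Won k (m + 1 + 1) (X (Fin.last (m + 1)) ^ 2 +
      rename (Fin.succAboveEmb (Fin.last (m + 1))) ((∏ l, X l ^ μ l) * U)) := by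
  classical
  set w : Fin (m + 1) → ℕ := fun l => if l = a ∨ l = b then 1 else 0 with hw
  have hwa : w a = 1 := by rw [hw]; dsimp only; rw [if_pos (Or.inl rfl)]
  have hwb : w b = 1 := by rw [hw]; dsimp only; rw [if_pos (Or.inr rfl)]
  have hwe : w e = 0 := by rw [hw]; dsimp only; rw [if_neg (not_or.mpr ⟨hea, heb⟩)]
  have hwle : ∀ l, w l ≤ 1 := fun l => by rw [hw]; dsimp only; split_ifs <;> omega
  have hwpos : ∀ l, w l ≠ 0 → l = a ∨ l = b := fun l hl => by
    by_contra h
    rw [hw] at hl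
    exact hl (if_neg h)
  have hdeg : ∑ l, w l * μ l = 2 := by rw [hw, sum_indicator_pair_mul hab, ha, hb]
  rw [dp_eq_sum]
  refine won_monic_of_linearBlowup p hp k (m + 1) 2 two_pos w
    (fun l hl hdvd => hp.one_lt.ne' (Nat.dvd_one.mp (by rwa [le_antisymm (hwle l) hl] at hdvd))) (![(∏ l, X l ^ μ l) * U, 0]) ?_ ?_
  · -- permissibility: `A₀ ∘ chart = s² · B` with `B(0) = 0` (the factor at `e` is `x_e'`)
    intro c hc j
    fin_cases j
    · refine ⟨(∏ l, (C (c l) + X l.succ) ^ μ l) * subst (CobordantChart.chart w c) U, ?_, ?_⟩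
      · simp only [Fin.zero_eta, Matrix.cons_val_zero, Nat.sub_zero]
        rw [subst_chart_prod_X_pow_mul w c hc, hdeg]
      · rw [map_mul, map_prod]
        refine mul_eq_zero_of_left (Finset.prod_eq_zero (Finset.mem_univ e) ?_) _
        rw [map_pow, map_add, constantCoeff_C, constantCoeff_X, add_zero, hc e hwe, he, pow_one]
    · refine ⟨0, ?_, map_zero _⟩
      simp only [Fin.mk_one, Matrix.cons_val_one, Matrix.cons_val_zero]
      rw [← coe_substAlgHom (CobordantChart.hasSubst_chart w c hc), map_zero, mul_zero]
  · -- the slice at a live slot `i₀ ∈ {a, b}`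
    intro c hc i₀ hci₀ B hB hS
    have hch := CobordantChart.hasSubst_chart w c hc
    have hX0 : (X 0 : MvPowerSeries (Fin (m + 1 + 1)) k) ≠ 0 := FormalCoordChange.X_ne_zero' 0
    -- identify the factorisation data
    have hB0 : B 0 = (∏ l, (C (c l) + X l.succ) ^ μ l) * subst (CobordantChart.chart w c) U := by
      have h := hB 0
      simp only [Matrix.cons_val_zero, Fin.val_zero, Nat.sub_zero] at h
      rw [subst_chart_prod_X_pow_mul w c hc, hdeg] at h
      exact (mul_left_cancel₀ (pow_ne_zero 2 hX0) h).symm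
    have hB1 : B 1 = 0 := by
      have h := hB 1
      simp only [Matrix.cons_val_one, Matrix.cons_val_zero, Fin.val_one] at h
      rw [← coe_substAlgHom hch, map_zero] at h
      rcases mul_eq_zero.mp h.symm with h1 | h1
      · exact absurd h1 (pow_ne_zero _ hX0)
      · exact h1
    -- the live slot is `a` or `b`
    have hi₀ : i₀ = a ∨ i₀ = b := hwpos i₀ (fun h => hci₀ (hc i₀ h))
    have hei₀ : e ≠ i₀ := by rintro rfl; rcases hi₀ with h | h; exact hea h; exact heb h
    -- the slice of `B 0` is `x^{μ''} · V` with `μ''` and the unit `V` below, up to the slot cycle `π`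
    set μ'' : Fin (m + 1) → ℕ := fun l => if l = i₀ then 0 else if c l = 0 then μ l else 0 with hμ''
    set V : Fin (m + 1) → MvPowerSeries (Fin (m + 1)) k := fun l => if μ l = 0 then 1 else
      if l = i₀ then C (c l) else if c l = 0 then 1 else C (c l) + X (Fin.cycleRange i₀ l) with hV
    have hfactor : ∀ l, (C (c l) + if l = i₀ then (0 : MvPowerSeries (Fin (m + 1)) k) else X (Fin.predAbove i₀ l.succ)) ^ μ l =
        X (Fin.cycleRange i₀ l) ^ μ'' l * V l := by
      intro l
      rw [hμ'', hV]
      dsimp only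
      rcases Nat.le_one_iff_eq_zero_or_eq_one.mp (hμ l) with h0 | h1
      · rw [h0, pow_zero, if_pos rfl]
        have : (if l = i₀ then 0 else if c l = 0 then 0 else 0) = 0 := by split_ifs <;> rfl
        rw [this, pow_zero, one_mul]
      · rw [h1, pow_one, if_neg one_ne_zero]
        by_cases hl : l = i₀
        · rw [if_pos hl, if_pos hl, if_pos hl, add_zero, pow_zero, one_mul]
        · rw [if_neg hl, if_neg hl, if_neg hl, predAbove_succ_eq_cycleRange i₀ l hl]
          by_cases hcl : c l = 0
          · rw [if_pos hcl, if_pos hcl, hcl, map_zero, zero_add, pow_one, mul_one]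
          · rw [if_neg hcl, if_neg hcl, pow_zero, one_mul]
    have hV0 : ∀ l, constantCoeff (V l) ≠ 0 := by
      intro l
      rw [hV]
      dsimp only
      split_ifs with h1 h2 h3
      · rw [map_one]; exact one_ne_zero
      · rw [constantCoeff_C, h2]; exact hci₀
      · rw [map_one]; exact one_ne_zero
      · rw [map_add, constantCoeff_C, constantCoeff_X, add_zero]; exact h3
    set W : MvPowerSeries (Fin (m + 1)) k := (∏ l, V l) * TupleGame.slice i₀ (subst (CobordantChart.chart w c) U) with hW
    have hW0 : constantCoeff W ≠ 0 := by
      rw [hW, map_mul, map_prod, WildTerminal.constantCoeff_slice, constantCoeff_subst_chart w c hc]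
      exact mul_ne_zero (Finset.prod_ne_zero_iff.mpr fun l _ => hV0 l) hU
    have hslice : TupleGame.slice i₀ (B 0) = (∏ l, X l ^ μ'' ((Fin.cycleRange i₀).symm l)) * W := by
      rw [hB0, slice_prod_linFactors_mul, Finset.prod_congr rfl fun l _ => hfactor l, Finset.prod_mul_distrib,
        ← Equiv.prod_comp (Fin.cycleRange i₀) (fun l => (X l : MvPowerSeries (Fin (m + 1)) k) ^ μ'' ((Fin.cycleRange i₀).symm l)), hW]
      simp only [Equiv.symm_apply_apply]
      ring
    have hform : X (Fin.last (m + 1)) ^ 2 + ∑ j : Fin 2, rename (Fin.succAboveEmb (Fin.last (m + 1)))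
        (TupleGame.slice i₀ (B j)) * X (Fin.last (m + 1)) ^ (j : ℕ) =
        X (Fin.last (m + 1)) ^ 2 + rename (Fin.succAboveEmb (Fin.last (m + 1))) ((∏ l, X l ^ μ'' ((Fin.cycleRange i₀).symm l)) * W) := by
      rw [Fin.sum_univ_two, hB1, hslice]
      unfold TupleGame.slice
      rw [← coe_substAlgHom (CobordantChartPlaneSlice.hasSubst_slice (R := k) (n := m + 1) i₀), map_zero]
      simp
    rw [hform]
    refine IH (fun l => μ'' ((Fin.cycleRange i₀).symm l)) W hW0 ⟨Fin.cycleRange i₀ e, ?_⟩ ?_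
    · -- `μ''_e = μ_e = 1` is odd
      rw [Equiv.symm_apply_apply, hμ'']
      dsimp only
      rw [if_neg hei₀, if_pos (hc e hwe), he]
      exact odd_one
    · -- `Σ μ'' < Σ μ`: `μ'' ≤ μ` and `μ''_{i₀} = 0 < 1 = μ_{i₀}`
      rw [Equiv.sum_comp (Fin.cycleRange i₀).symm (fun l => μ'' l)]
      have hμi₀ : μ i₀ = 1 := by rcases hi₀ with rfl | rfl; exact ha; exact hb
      refine Finset.sum_lt_sum (fun l _ => ?_) ⟨i₀, Finset.mem_univ _, ?_⟩
      · rw [hμ'']; dsimp only; split_ifs <;> omega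
      · rw [hμ'']; dsimp only; rw [if_pos rfl, hμi₀]; exact one_pos

end TerminalDoublePointDim

end Summit.ResolutionOfSingularities.ResolutionOfSingularities.Theorems
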